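import Summits.Ventures.QEC.CircuitDistance.SchedFamilyCeilingValid
import Summits.Ventures.QEC.CircuitDistance.SchedValueBB144o345
import HarnessLib

/-!
# `[[144,12,12]]` — the family ceiling is ATTAINED: `11` is the greatest value of `circuitDistanceₛ σ bb144SM Nc` over the valid orders
# (venture QEC, experiment cell CDX; packaging of `SchedFamilyCeilingValid` (≤ 11 for every valid order) with the landed Q4 word
# `sched345_circuitDistance_eq_eleven` (order #345 = 11, `SchedValueBB144o345` p709149); no value of print's own `d_circ` (order #204) is touched)

Provenance: typed by qec-cdx-type-1 g4 (2026-08-29). KERNEL FACTS ONLY — whether and how this is WORDED («maximum over the family») is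
the director's (R169 (3) / R174); IN MODEL; RIDER L (numbering ours, print matches `#345` to no printed variant one-to-one; acq-14097) and
EXT travel with any use. Nothing here changes a deployed code.
-/

namespace Summit.Ventures.QEC.CircuitDistance

namespace SMSchedule

/-- The bound `11` is attained by a valid order: #345 (the landed Q4 word). -/
theorem exists_valid_circuitDistanceₛ_eq_eleven :
    ∃ σ : SMSchedule, σ.Valid ∧ ∀ Nc : ℕ, 1 ≤ Nc → circuitDistanceₛ σ bb144SM Nc = 11 :=
  ⟨sched345, sched345_valid, sched345_circuitDistance_eq_eleven⟩

/-- For every `Nc ≥ 1`, `11` is the GREATEST element of `{circuitDistanceₛ σ bb144SM Nc | σ valid}` (in model). -/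
theorem isGreatest_circuitDistanceₛ_valid (Nc : ℕ) (hNc : 1 ≤ Nc) :
    IsGreatest {d : ℕ | ∃ σ : SMSchedule, σ.Valid ∧ d = circuitDistanceₛ σ bb144SM Nc} 11 := by
  refine ⟨⟨sched345, sched345_valid, (sched345_circuitDistance_eq_eleven Nc hNc).symm⟩, ?_⟩
  rintro d ⟨σ, hσ, rfl⟩
  exact circuitDistanceₛ_le_eleven_of_valid σ hσ Nc hNc

/-- Equivalently: the valid orders' circuit distances at `Nc ≥ 1` are bounded by `11` and some valid order reaches `11`. -/
theorem family_ceiling_and_attained (Nc : ℕ) (hNc : 1 ≤ Nc) :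
    (∀ σ : SMSchedule, σ.Valid → circuitDistanceₛ σ bb144SM Nc ≤ 11) ∧ (∃ σ : SMSchedule, σ.Valid ∧ circuitDistanceₛ σ bb144SM Nc = 11) :=
  ⟨fun σ hσ => circuitDistanceₛ_le_eleven_of_valid σ hσ Nc hNc, ⟨sched345, sched345_valid, sched345_circuitDistance_eq_eleven Nc hNc⟩⟩

end SMSchedule

end Summit.Ventures.QEC.CircuitDistance
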